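import Summits.QuantumFields.YangMills.Theses.BalabanTowerExport
import Summits.QuantumFields.YangMills.Theorems.BalabanTowerExportTowerGlueToolkit
import HarnessLib

/-!
# `BalabanTowerExport.TowerExportGlue` (item stmt-QuantumFields-27385, support, provable-now)

`TowerDecoupling → CondResponse → BalabanFamilyExport.FamilyCeilings` — the bookkeeping of the
reverse-martingale tower across Bałaban's block levels (route BalabanTowerExport, ideator ym-idea-9):
`L := 13`; a class torus `M = 2·13ᵉ` is the finest lattice of the family `F = (13, e)` at `K = 0`; the depth
is `k := ⌊log₁₃ (R/17)⌋` (`13ᵏ ≤ R < 221·13ᵏ`, `17·13ᵏ ≤ R` once `k ≥ 1`); `CondResponse` at every depth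
`a ≤ k` gives everywhere-bounded versions `g⁽ᵃ⁾` of `E[pᵢ | Q_a]` (`g⁽ᵃ⁾ := mᵢ` above `k`), the level
differences `D⁽ᵃ⁾ := g⁽ᵃ⁾∘Q_a − g⁽ᵃ⁺¹⁾∘Q_{a+1}` telescope to `g⁽⁰⁾∘Q_0 − mᵢ = pᵢ − mᵢ` a.e. (level-0
identification: `Q_0 = ofConfig` is a re-indexing, so `pᵢ − g⁽⁰⁾∘Q_0` is an admissible level-0 test function
orthogonal to itself); the product is expanded over level assignments, the two top levels `k−1, k`
(functions of `Q_{k−1}V`, `Q_k = blockAvg ∘ Q_{k−1}` definitionally) go normalised into the tilt `Φ`, and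
`TowerDecoupling` (depth `k = k'+2`, low sub-family re-indexed along `Fin #S ≃ S`) bounds each term by
`∏ᵢ w(σ i)`; resummation (`Toolkit.abs_integral_prod_sum_le`) and the geometric level-weight sum
(`Toolkit.levelWeights_sum_le`) give `(C_w/13^{4k})ⁿ ≤ (C_w·221⁴/R⁴)ⁿ`.

Elementary measure-theoretic bookkeeping (the route's own "provable now" support item). Nothing of E0′
itself, of `TowerDecoupling`/`CondResponse`, of NT or of the gap is proved here; the route is a DRAFT
line on the spine crux `UVSeamRec` (20043); the YM mass gap is NOT proved by any of this.
-/

set_option autoImplicit false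

namespace Summit.QuantumFields.YangMills.Theorems.BalabanTowerExport

open MeasureTheory
open Literature.MathematicalPhysics.QuantumFieldTheory
open Literature.MathematicalPhysics.QuantumFieldTheory.Balaban1983to89
open Literature.MathematicalPhysics.QuantumFieldTheory.Balaban1983to89.T4Continuum
open Literature.MathematicalPhysics.QuantumLattice (LGConfig torusLift fundamentalLatticeRep)
open Summit.QuantumFields.YangMills.Cruxes.OSLegsFromFemtoAndGap.DlrCollarTransfer (plane)
open Summit.QuantumFields.YangMills.Cruxes.UV.TorusClass (torusEOn MomentBounds6OnSides)
open Summit.QuantumFields.YangMills.Theses.BalabanTowerExport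
open Summit.QuantumFields.YangMills.Theorems.BalabanTowerExport.Toolkit

/-- **Route item `BalabanTowerExport.TowerExportGlue` (stmt-QuantumFields-27385):**
`TowerDecoupling → CondResponse → BalabanFamilyExport.FamilyCeilings`, by the reverse-martingale
telescoping over Bałaban's block levels `0..k` at `L := 13`, `K := 0`, `m := e` for the class torus
`M = 2·13ᵉ`, depth `k := ⌊log₁₃ (R/17)⌋`, the level-assignment expansion, `TowerDecoupling` on the levels
`≤ k − 2` against the tilt carrying the two top levels, and the geometric resummation of the level weights. -/
theorem towerExportGlue_proof : TowerExportGlue := by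
  intro hTD hCR
  letI : MeasurableSpace (Matrix.specialUnitaryGroup (Fin 2) ℂ) := borel _
  haveI : BorelSpace (Matrix.specialUnitaryGroup (Fin 2) ℂ) := ⟨rfl⟩
  obtain ⟨C₁, δ, β₁, ℓ₁, hδ, hℓ₁, hC₁, h₁⟩ := hTD 13 (by decide) (by norm_num)
  obtain ⟨C, β₂, ℓ₂, hℓ₂, hC, h₂⟩ := hCR 13 (by decide) (by norm_num)
  -- constants: level sizes `A/13^{4a}`, `ρ = 13^{-δ}`, export constant `Cw·221⁴`
  set A : ℝ := 2 * (C + 1) with hA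
  have hA0 : 0 < A := by positivity
  have hρ0 : 0 ≤ ((13 : ℕ) : ℝ)⁻¹ ^ δ := Real.rpow_nonneg (by positivity) δ
  have hρ1 : ((13 : ℕ) : ℝ)⁻¹ ^ δ < 1 := Real.rpow_lt_one (by positivity) (by norm_num) hδ
  set Cw : ℝ := A * ((13 : ℕ) : ℝ) ^ 4 *
    (2 + C₁ * (((13 : ℕ) : ℝ)⁻¹ ^ δ / (1 - ((13 : ℕ) : ℝ)⁻¹ ^ δ))) with hCw
  have hCw0 : 0 ≤ Cw := by
    have : 0 ≤ ((13 : ℕ) : ℝ)⁻¹ ^ δ / (1 - ((13 : ℕ) : ℝ)⁻¹ ^ δ) := div_nonneg hρ0 (by linarith)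
    positivity
  refine ⟨13, by decide, by norm_num, Cw * 221 ^ 4, max β₁ β₂, min ℓ₁ ℓ₂, lt_min hℓ₁ hℓ₂,
    by positivity, ?_⟩
  intro β hβ M instM hM n q x R hq hR hRu hRM hsep
  obtain ⟨e, he, hMe⟩ := hM
  -- realise the class torus as the finest lattice of the Bałaban family `(L, m) = (13, e)` at `K = 0`
  obtain ⟨F, hFL, hFm⟩ : ∃ F : T4Family, F.L = 13 ∧ F.m = e :=
    ⟨⟨13, ⟨by decide, by norm_num⟩, by norm_num, e, he⟩, rfl, rfl⟩
  have hFM : (F.P 0).sitesPerDir 0 = M := by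
    rw [T4Family.sitesPerDir_eq, hFL, hFm, hMe, Nat.add_zero]
  subst hFM
  have hβ₁ : β₁ ≤ β := (le_max_left _ _).trans hβ
  have hβ₂ : β₂ ≤ β := (le_max_right _ _).trans hβ
  have huR : 0 < Summit.QuantumFields.YangMills.Cruxes.UVSeamRec.Transport.uRec β :=
    Summit.QuantumFields.YangMills.Cruxes.UVSeamRec.UnitTransfer.uRec_pos β
  -- the depth `k = ⌊log₁₃ (R / 17)⌋`
  obtain ⟨k, hk1, hk2, hk3⟩ : ∃ k : ℕ, 13 ^ k ≤ R ∧ R < 221 * 13 ^ k ∧ (2 ≤ k → 17 * 13 ^ k ≤ R) := by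
    refine ⟨Nat.log 13 (R / 17), ?_, ?_, ?_⟩
    · by_cases h17 : R / 17 = 0
      · rw [h17, Nat.log_zero_right, pow_zero]; exact hR
      · have := Nat.pow_log_le_self 13 h17; omega
    · have := Nat.lt_pow_succ_log_self (b := 13) (by norm_num) (R / 17)
      rw [pow_succ] at this; omega
    · intro h2
      have h17 : R / 17 ≠ 0 := by
        intro h0; rw [h0, Nat.log_zero_right] at h2; omega
      have := Nat.pow_log_le_self 13 h17; omega
  have hke : k + 1 ≤ F.m + 0 := by
    rw [hFm, Nat.add_zero]
    have h13 : 13 ^ k < 13 ^ e := by have := hMe; omega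
    exact Nat.succ_le_of_lt ((Nat.pow_lt_pow_iff_right (by norm_num)).1 h13)
  have h13R : ((13 : ℕ) : ℝ) ^ k ≤ (R : ℝ) := by exact_mod_cast hk1
  -- vocabulary
  set Mx : ℕ := (F.P 0).sitesPerDir 0 with hMxdef
  set Q : (j : ℕ) → GaugeConfig 4 Mx (Matrix.specialUnitaryGroup (Fin 2) ℂ) →
      GaugeField (F.P 0) j (Matrix.specialUnitaryGroup (Fin 2) ℂ) :=
    fun j V => Averaging.iter (fun i => BlockAveraging.blockAvg (P := F.P 0) (j := i) su2Mean) j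
      (ofConfig (P := F.P 0) (j := 0) V) with hQdef
  set μ : Measure (GaugeConfig 4 Mx (Matrix.specialUnitaryGroup (Fin 2) ℂ)) :=
    wilsonMeasure (d := 4) (L := Mx) (fundamentalLatticeRep 2).ρ β with hμdef
  set pV : Fin n → GaugeConfig 4 Mx (Matrix.specialUnitaryGroup (Fin 2) ℂ) → ℝ :=
    fun i V => plane (Matrix.specialUnitaryGroup (Fin 2) ℂ) (fundamentalLatticeRep 2) (q i) (x i)
      (torusLift Mx V) with hpVdef
  set mV : Fin n → ℝ := fun i => torusEOn (Matrix.specialUnitaryGroup (Fin 2) ℂ)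
    (fundamentalLatticeRep 2) β Mx
    (plane (Matrix.specialUnitaryGroup (Fin 2) ℂ) (fundamentalLatticeRep 2) (q i) (x i)) with hmVdef
  -- CondResponse at every insertion and every depth `a ≤ k` (constant `mᵢ` above `k`)
  have hg : ∀ (i : Fin n) (a : ℕ),
      ∃ g : GaugeField (F.P 0) a (Matrix.specialUnitaryGroup (Fin 2) ℂ) → ℝ,
        Measurable (fun V => g (Q a V)) ∧ (∀ W, |g W - mV i| ≤ C / (((13 : ℕ) : ℝ) ^ a) ^ 4) ∧
        (a ≤ k → ∀ φ : GaugeField (F.P 0) a (Matrix.specialUnitaryGroup (Fin 2) ℂ) → ℝ,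
          Measurable (fun V => φ (Q a V)) → (∀ W, |φ W| ≤ 1) →
          ∫ V, (pV i V - g (Q a V)) * φ (Q a V) ∂μ = 0) ∧
        (k < a → ∀ W, g W = mV i) := by
    intro i a
    by_cases ha : a ≤ k
    · have hae : a + 1 ≤ F.m + 0 := by omega
      have hwin : ((13 : ℕ) : ℝ) ^ a *
          Summit.QuantumFields.YangMills.Cruxes.UVSeamRec.Transport.uRec β ≤ ℓ₂ := by
        have h1 : ((13 : ℕ) : ℝ) ^ a ≤ ((13 : ℕ) : ℝ) ^ k := pow_le_pow_right₀ (by norm_num) ha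
        exact (mul_le_mul_of_nonneg_right (h1.trans h13R) huR.le).trans
          (hRu.trans (min_le_right _ _))
      obtain ⟨g, hgm, hgb, hgo⟩ := h₂ β hβ₂ F 0 a hFL hae hwin (q i) (x i) (hq i)
      exact ⟨g, hgm, hgb, fun _ => hgo, fun h => absurd ha (not_le.2 h)⟩
    · refine ⟨fun _ => mV i, measurable_const, fun W => ?_, fun h => absurd h ha, fun _ _ => rfl⟩
      rw [sub_self, abs_zero]; positivity
  choose g hgm hgb hgo hgc using hg
  have hgb2 : ∀ i a W, |g i (a + 1) W - mV i| ≤ C / (((13 : ℕ) : ℝ) ^ a) ^ 4 := fun i a W =>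
    (hgb i (a + 1) W).trans (div_le_div_of_nonneg_left hC (by positivity)
      (pow_le_pow_left₀ (by positivity) (pow_le_pow_right₀ (by norm_num) (Nat.le_succ a)) 4))
  have hgB : ∀ i a W, |g i a W| ≤ |mV i| + C := fun i a W => by
    linarith [(hgb i a W).trans (div_le_self hC (one_le_pow₀ (one_le_pow₀ (by norm_num)))),
      abs_sub_abs_le_abs_sub (g i a W) (mV i)]
  -- the level differences `D⁽ᵃ⁾ = g⁽ᵃ⁾∘Q_a − g⁽ᵃ⁺¹⁾∘Q_{a+1}` and their sizes
  set D : Fin n → ℕ → GaugeConfig 4 Mx (Matrix.specialUnitaryGroup (Fin 2) ℂ) → ℝ :=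
    fun i a V => g i a (Q a V) - g i (a + 1) (Q (a + 1) V) with hDdef
  set sz : ℕ → ℝ := fun a => A / (((13 : ℕ) : ℝ) ^ a) ^ 4 with hszdef
  have hszpos : ∀ a, 0 < sz a := fun a => by positivity
  have hsz2 : ∀ a, C / (((13 : ℕ) : ℝ) ^ a) ^ 4 + C / (((13 : ℕ) : ℝ) ^ a) ^ 4 ≤ sz a := by
    intro a
    rw [hszdef, ← add_div]
    exact div_le_div_of_nonneg_right (by rw [hA]; linarith) (by positivity)
  have hDm : ∀ i a, Measurable (D i a) := fun i a => (hgm i a).sub (hgm i (a + 1))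
  have hDb : ∀ i a V, |D i a V| ≤ sz a := by
    intro i a V
    have h3 := abs_sub_le (g i a (Q a V)) (mV i) (g i (a + 1) (Q (a + 1) V))
    rw [abs_sub_comm (mV i)] at h3
    exact h3.trans ((add_le_add (hgb i a _) (hgb2 i a _)).trans (hsz2 a))
  -- the probability space and the bounded plane observables
  haveI : IsProbabilityMeasure μ :=
    isProbabilityMeasure_wilsonMeasure (d := 4) (L := Mx) (fundamentalLatticeRep 2).ρ
      (fundamentalLatticeRep 2).continuous β
  obtain ⟨B, hB⟩ :=
    Summit.QuantumFields.YangMills.Cruxes.OSLegsFromFemtoAndGap.DlrCollarTransfer.exists_abs_plane_le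
      (G := Matrix.specialUnitaryGroup (Fin 2) ℂ) (fundamentalLatticeRep 2)
  have hpVm : ∀ i, Measurable (pV i) := fun i =>
    (Summit.QuantumFields.YangMills.Cruxes.OSLegsFromFemtoAndGap.DlrCollarTransfer.continuous_plane
      (G := Matrix.specialUnitaryGroup (Fin 2) ℂ) (fundamentalLatticeRep 2) (q i) (x i)).measurable.comp
      (measurable_torusLift (d := 4) (G := Matrix.specialUnitaryGroup (Fin 2) ℂ) Mx)
  have hint1 : ∀ (f : GaugeConfig 4 Mx (Matrix.specialUnitaryGroup (Fin 2) ℂ) → ℝ),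
      Measurable f → (∀ V, |f V| ≤ 1) → ∫ V, |f V| ∂μ ≤ 1 := by
    intro f hfm hfb
    have hfi : Integrable (fun V => |f V|) μ :=
      (Integrable.mono' (integrable_const (1 : ℝ)) hfm.aestronglyMeasurable
        (Filter.Eventually.of_forall fun V => by rw [Real.norm_eq_abs]; exact hfb V)).abs
    calc ∫ V, |f V| ∂μ ≤ ∫ _V, (1 : ℝ) ∂μ := integral_mono hfi (integrable_const _) fun V => hfb V
      _ = 1 := by simp
  -- level-0 identification: `pᵢ = g⁽⁰⁾∘Q_0` a.e. (`Q_0 = ofConfig` is a re-indexing)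
  have hae : ∀ i, (fun V => pV i V - g i 0 (Q 0 V)) =ᵐ[μ] 0 := by
    intro i
    set Dt : ℝ := |B| + (|mV i| + C) + 1 with hDt
    have hDt0 : 0 < Dt := by positivity
    let φ : GaugeField (F.P 0) 0 (Matrix.specialUnitaryGroup (Fin 2) ℂ) → ℝ := fun W =>
      (plane (Matrix.specialUnitaryGroup (Fin 2) ℂ) (fundamentalLatticeRep 2) (q i) (x i)
        (torusLift Mx (toConfig W)) - g i 0 W) / Dt
    have hφQ : ∀ V, φ (Q 0 V) = (pV i V - g i 0 (Q 0 V)) / Dt := fun V => rfl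
    have hφm : Measurable (fun V => φ (Q 0 V)) := by
      simp_rw [hφQ]
      exact ((hpVm i).sub (hgm i 0)).div_const _
    have hφb : ∀ W, |φ W| ≤ 1 := by
      intro W
      change |(_ - _) / Dt| ≤ 1
      rw [abs_div, abs_of_pos hDt0, div_le_one hDt0]
      have h1 := hB (q i) (x i) (torusLift Mx (toConfig W))
      have h2 := hgB i 0 W
      have h3 := abs_sub (plane (Matrix.specialUnitaryGroup (Fin 2) ℂ) (fundamentalLatticeRep 2)
        (q i) (x i) (torusLift Mx (toConfig W))) (g i 0 W)
      linarith [le_abs_self B]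
    have horth : ∫ V, (pV i V - g i 0 (Q 0 V)) * ((pV i V - g i 0 (Q 0 V)) / Dt) ∂μ = 0 :=
      hgo i 0 (Nat.zero_le k) φ hφm hφb
    have hfb : ∀ V, |pV i V - g i 0 (Q 0 V)| ≤ |B| + (|mV i| + C) := fun V => by
      linarith [le_abs_self B, hB (q i) (x i) (torusLift Mx V), hgB i 0 (Q 0 V),
        abs_sub (pV i V) (g i 0 (Q 0 V))]
    exact ae_eq_zero_of_integral_mul_self_div μ _ ((hpVm i).sub (hgm i 0)) hfb hDt0 horth
  -- the centred product telescopes into the level differences, a.e.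
  have hprodae : (fun V => ∏ i, (pV i V - mV i)) =ᵐ[μ]
      fun V => ∏ i, (∑ a ∈ Finset.range (k + 1), D i a V) := by
    have hall : ∀ᵐ V ∂μ, ∀ i, pV i V - g i 0 (Q 0 V) = 0 := by
      rw [ae_all_iff]
      intro i
      filter_upwards [hae i] with V hV
      simpa using hV
    filter_upwards [hall] with V hV
    refine Finset.prod_congr rfl fun i _ => ?_
    have htel : ∑ a ∈ Finset.range (k + 1), D i a V = g i 0 (Q 0 V) - g i (k + 1) (Q (k + 1) V) :=
      Finset.sum_range_sub' (fun a => g i a (Q a V)) (k + 1)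
    rw [htel, hgc i (k + 1) (Nat.lt_succ_self k)]
    linarith [hV i]
  -- the level weights
  set w : ℕ → ℝ := fun a => if a + 2 ≤ k then
      C₁ * (((13 : ℕ) : ℝ) ^ (a + 1) / ((13 : ℕ) : ℝ) ^ k) ^ (4 + δ) * sz a else sz a with hwdef
  have hw0 : ∀ a, 0 ≤ w a := by
    intro a
    simp only [hwdef]
    split_ifs
    · exact mul_nonneg (mul_nonneg hC₁ (Real.rpow_nonneg (by positivity) _)) (hszpos a).le
    · exact (hszpos a).le
  -- PER-ASSIGNMENT BOUND: `|∫ ∏ᵢ Dᵢ^(σ i) dμ| ≤ ∏ᵢ w (σ i)`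
  have hT : ∀ σ : Fin n → ℕ, (∀ i, σ i < k + 1) →
      |∫ V, ∏ i, D i (σ i) V ∂μ| ≤ ∏ i, w (σ i) := by
    intro σ hσ
    classical
    by_cases hlow : ∃ i, σ i + 2 ≤ k
    · -- some insertion sits at a deep level: `k = k' + 2`, TowerDecoupling on the low sub-family
      obtain ⟨i₀, hi₀⟩ := hlow
      have h17 : 17 * 13 ^ k ≤ R := hk3 (by omega)
      obtain ⟨k', rfl⟩ : ∃ k', k = k' + 2 := ⟨k - 2, by omega⟩
      have hke2 : k' + 2 + 2 ≤ F.m + 0 := by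
        rw [hFm, Nat.add_zero]
        have h13 : 13 ^ (k' + 2 + 1) < 13 ^ e := by
          have := hMe; rw [pow_succ]; omega
        have := (Nat.pow_lt_pow_iff_right (by norm_num : 1 < 13)).1 h13
        omega
      have hwin : ((13 : ℕ) : ℝ) ^ (k' + 2) *
          Summit.QuantumFields.YangMills.Cruxes.UVSeamRec.Transport.uRec β ≤ ℓ₁ :=
        (mul_le_mul_of_nonneg_right h13R huR.le).trans (hRu.trans (min_le_left _ _))
      -- the low sub-family `S`, re-indexed along `Fin #S ≃ S`
      set S : Finset (Fin n) := Finset.univ.filter (fun i => σ i + 2 ≤ k' + 2) with hSdef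
      let ι : Fin S.card → Fin n := fun j => ((S.equivFin.symm j : S) : Fin n)
      have hιmem : ∀ j, ι j ∈ S := fun j => (S.equivFin.symm j).2
      have hιinj : Function.Injective ι := fun j j' h =>
        S.equivFin.symm.injective (Subtype.ext h)
      have hιlow : ∀ j, σ (ι j) + 2 ≤ k' + 2 := fun j => (Finset.mem_filter.1 (hιmem j)).2
      have hsep' : ∀ i j : Fin S.card, i ≠ j → ∃ κ : Fin 4,
          (34 * ((13 : ℕ) : ℤ) ^ (k' + 2) + 4) ≤
            |((((x (ι i) κ - x (ι j) κ : ℤ) : ZMod Mx)).valMinAbs : ℤ)| := by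
        intro i j hij
        obtain ⟨κ, hκ⟩ := hsep (ι i) (ι j) (fun h => hij (hιinj h))
        refine ⟨κ, le_trans ?_ hκ⟩
        have : 17 * ((13 : ℕ) : ℤ) ^ (k' + 2) ≤ (R : ℤ) := by exact_mod_cast h17
        linarith
      have hnotS : ∀ i, i ∉ S → σ i = k' + 1 ∨ σ i = k' + 2 := by
        intro i hi
        have h1 := hσ i
        have h2 : ¬ (σ i + 2 ≤ k' + 2) := fun h => hi (Finset.mem_filter.2 ⟨Finset.mem_univ _, h⟩)
        omega
      -- the top-level factors as functions of the depth-`(k'+1)` block field, and the tilt `Φ`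
      let av1 := (BlockAveraging.blockAvg (P := F.P 0) (j := k' + 1)
        (su2Mean : LoopAverage (Matrix.specialUnitaryGroup (Fin 2) ℂ))).avg
      let av2 := (BlockAveraging.blockAvg (P := F.P 0) (j := k' + 2)
        (su2Mean : LoopAverage (Matrix.specialUnitaryGroup (Fin 2) ℂ))).avg
      let E : Fin n → GaugeField (F.P 0) (k' + 1) (Matrix.specialUnitaryGroup (Fin 2) ℂ) → ℝ :=
        fun i W => if σ i = k' + 1 then g i (k' + 1) W - g i (k' + 2) (av1 W)
          else g i (k' + 2) (av1 W) - g i (k' + 3) (av2 (av1 W))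
      have hEQ : ∀ i, i ∉ S → ∀ V, E i (Q (k' + 1) V) = D i (σ i) V := by
        intro i hi V
        rcases hnotS i hi with h | h
        · simp only [E, if_pos h]; rw [h]; rfl
        · have hne : σ i ≠ k' + 1 := by omega
          simp only [E, if_neg hne]; rw [h]; rfl
      have hEb : ∀ i, i ∉ S → ∀ W, |E i W| ≤ sz (σ i) := by
        intro i hi W
        rcases hnotS i hi with h | h
        · simp only [E, if_pos h]
          rw [h]
          have h3 := abs_sub_le (g i (k' + 1) W) (mV i) (g i (k' + 2) (av1 W))
          rw [abs_sub_comm (mV i)] at h3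
          exact h3.trans ((add_le_add (hgb i (k' + 1) _) (hgb2 i (k' + 1) _)).trans (hsz2 (k' + 1)))
        · have hne : σ i ≠ k' + 1 := by omega
          simp only [E, if_neg hne]
          rw [h]
          have h3 := abs_sub_le (g i (k' + 2) (av1 W)) (mV i) (g i (k' + 3) (av2 (av1 W)))
          rw [abs_sub_comm (mV i)] at h3
          exact h3.trans ((add_le_add (hgb i (k' + 2) _) (hgb2 i (k' + 2) _)).trans (hsz2 (k' + 2)))
      have hEm : ∀ i, Measurable (fun V => E i (Q (k' + 1) V)) := by
        intro i
        by_cases h : σ i = k' + 1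
        · simp only [E, if_pos h]; exact (hgm i (k' + 1)).sub (hgm i (k' + 2))
        · simp only [E, if_neg h]; exact (hgm i (k' + 2)).sub (hgm i (k' + 3))
      let Φ : GaugeField (F.P 0) (k' + 1) (Matrix.specialUnitaryGroup (Fin 2) ℂ) → ℝ := fun W =>
        (∏ i ∈ Sᶜ, E i W) / ∏ i ∈ Sᶜ, sz (σ i)
      have hPpos : 0 < ∏ i ∈ Sᶜ, sz (σ i) := Finset.prod_pos fun i _ => hszpos _
      have hΦb : ∀ W, |Φ W| ≤ 1 := by
        intro W
        change |(∏ i ∈ Sᶜ, E i W) / ∏ i ∈ Sᶜ, sz (σ i)| ≤ 1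
        rw [abs_div, abs_of_pos hPpos, div_le_one hPpos, Finset.abs_prod]
        exact Finset.prod_le_prod (fun i _ => abs_nonneg _) fun i hi =>
          hEb i (Finset.mem_compl.1 hi) W
      have hΦm : Measurable (fun V => Φ (Q (k' + 1) V)) := by
        change Measurable (fun V => (∏ i ∈ Sᶜ, E i (Q (k' + 1) V)) / ∏ i ∈ Sᶜ, sz (σ i))
        exact (Finset.measurable_prod _ fun i _ => hEm i).div_const _
      have hΦint : ∫ V, |Φ (Q (k' + 1) V)| ∂μ ≤ 1 := hint1 _ hΦm fun V => hΦb _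
      -- TowerDecoupling on the low sub-family against the tilt `Φ`
      have key : |∫ V, (∏ j, (g (ι j) (σ (ι j)) (Q (σ (ι j)) V) -
            g (ι j) (σ (ι j) + 1) (Q (σ (ι j) + 1) V))) * Φ (Q (k' + 1) V) ∂μ| ≤
          (∏ j, C₁ * (((13 : ℕ) : ℝ) ^ (σ (ι j) + 1) / ((13 : ℕ) : ℝ) ^ (k' + 2)) ^ (4 + δ) *
            sz (σ (ι j))) * ∫ V, |Φ (Q (k' + 1) V)| ∂μ :=
        h₁ β hβ₁ F 0 (k' + 2) hFL hke2 hwin S.card (fun j => q (ι j)) (fun j => x (ι j))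
          (fun j => σ (ι j)) (fun j => hq (ι j)) hιlow hsep'
          (fun j => g (ι j) (σ (ι j))) (fun j => g (ι j) (σ (ι j) + 1)) (fun j => sz (σ (ι j)))
          (fun j => hgm (ι j) (σ (ι j))) (fun j => hgm (ι j) (σ (ι j) + 1))
          (fun j => ⟨|mV (ι j)| + C, fun W => hgB (ι j) _ W, fun W => hgB (ι j) _ W⟩)
          (fun j => hgo (ι j) (σ (ι j)) (by have := hιlow j; omega))
          (fun j => hgo (ι j) (σ (ι j) + 1) (by have := hιlow j; omega))
          (fun j V => hDb (ι j) (σ (ι j)) V) Φ hΦm hΦb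
      -- split the level product along `S` / `Sᶜ`
      have hsplit : (fun V => ∏ i, D i (σ i) V) = fun V => (∏ i ∈ Sᶜ, sz (σ i)) *
          ((∏ j, (g (ι j) (σ (ι j)) (Q (σ (ι j)) V) - g (ι j) (σ (ι j) + 1) (Q (σ (ι j) + 1) V))) *
            Φ (Q (k' + 1) V)) := by
        funext V
        have e1 : ∏ j, (g (ι j) (σ (ι j)) (Q (σ (ι j)) V) -
            g (ι j) (σ (ι j) + 1) (Q (σ (ι j) + 1) V)) = ∏ i ∈ S, D i (σ i) V := by
          change ∏ j, D (ι j) (σ (ι j)) V = _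
          rw [Fintype.prod_equiv S.equivFin.symm (fun j => D (ι j) (σ (ι j)) V)
            (fun s : S => D (s : Fin n) (σ s) V) fun j => rfl]
          exact Finset.prod_coe_sort S (fun i => D i (σ i) V)
        have e3 : ∏ i ∈ Sᶜ, D i (σ i) V = (∏ i ∈ Sᶜ, sz (σ i)) * Φ (Q (k' + 1) V) := by
          change _ = (∏ i ∈ Sᶜ, sz (σ i)) * ((∏ i ∈ Sᶜ, E i (Q (k' + 1) V)) / ∏ i ∈ Sᶜ, sz (σ i))
          rw [mul_div_cancel₀ _ hPpos.ne']
          exact Finset.prod_congr rfl fun i hi => (hEQ i (Finset.mem_compl.1 hi) V).symm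
        rw [← Finset.prod_mul_prod_compl S (fun i => D i (σ i) V), e3, e1]
        ring
      rw [hsplit, integral_const_mul, abs_mul, abs_of_pos hPpos]
      have hlowprod : ∏ j, C₁ * (((13 : ℕ) : ℝ) ^ (σ (ι j) + 1) / ((13 : ℕ) : ℝ) ^ (k' + 2)) ^ (4 + δ) *
          sz (σ (ι j)) = ∏ i ∈ S, w (σ i) := by
        rw [Fintype.prod_equiv S.equivFin.symm
          (fun j => C₁ * (((13 : ℕ) : ℝ) ^ (σ (ι j) + 1) / ((13 : ℕ) : ℝ) ^ (k' + 2)) ^ (4 + δ) *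
            sz (σ (ι j)))
          (fun s : S => C₁ * (((13 : ℕ) : ℝ) ^ (σ s + 1) / ((13 : ℕ) : ℝ) ^ (k' + 2)) ^ (4 + δ) *
            sz (σ s)) fun j => rfl,
          Finset.prod_coe_sort S (fun i => C₁ *
            (((13 : ℕ) : ℝ) ^ (σ i + 1) / ((13 : ℕ) : ℝ) ^ (k' + 2)) ^ (4 + δ) * sz (σ i))]
        refine Finset.prod_congr rfl fun i hi => ?_
        simp only [hwdef, if_pos (Finset.mem_filter.1 hi).2]
      have hhighprod : ∏ i ∈ Sᶜ, sz (σ i) = ∏ i ∈ Sᶜ, w (σ i) := by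
        refine Finset.prod_congr rfl fun i hi => ?_
        have h2 : ¬ (σ i + 2 ≤ k' + 2) := fun h =>
          (Finset.mem_compl.1 hi) (Finset.mem_filter.2 ⟨Finset.mem_univ _, h⟩)
        simp only [hwdef, if_neg h2]
      have hlow0 : 0 ≤ ∏ j, C₁ * (((13 : ℕ) : ℝ) ^ (σ (ι j) + 1) / ((13 : ℕ) : ℝ) ^ (k' + 2)) ^ (4 + δ) *
          sz (σ (ι j)) := Finset.prod_nonneg fun j _ =>
        mul_nonneg (mul_nonneg hC₁ (Real.rpow_nonneg (by positivity) _)) (hszpos _).le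
      calc (∏ i ∈ Sᶜ, sz (σ i)) * |∫ V, (∏ j, (g (ι j) (σ (ι j)) (Q (σ (ι j)) V) -
              g (ι j) (σ (ι j) + 1) (Q (σ (ι j) + 1) V))) * Φ (Q (k' + 1) V) ∂μ|
          ≤ (∏ i ∈ Sᶜ, sz (σ i)) * ((∏ j, C₁ *
              (((13 : ℕ) : ℝ) ^ (σ (ι j) + 1) / ((13 : ℕ) : ℝ) ^ (k' + 2)) ^ (4 + δ) * sz (σ (ι j))) * 1) :=
            mul_le_mul_of_nonneg_left (key.trans (mul_le_mul_of_nonneg_left hΦint hlow0)) hPpos.le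
        _ = (∏ i ∈ S, w (σ i)) * ∏ i ∈ Sᶜ, w (σ i) := by rw [mul_one, hlowprod, hhighprod, mul_comm]
        _ = ∏ i, w (σ i) := Finset.prod_mul_prod_compl S _
    · -- every insertion sits at one of the two top levels: the sup bound
      push Not at hlow
      have hw : ∀ i, w (σ i) = sz (σ i) := fun i => by
        simp only [hwdef, if_neg (not_le.2 (hlow i))]
      have hPi : Integrable (fun V => ∏ i, D i (σ i) V) μ :=
        Integrable.mono' (integrable_const (∏ i, sz (σ i)))
          (Finset.measurable_prod _ fun i _ => hDm i (σ i)).aestronglyMeasurable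
          (Filter.Eventually.of_forall fun V => by
            rw [Real.norm_eq_abs, Finset.abs_prod]
            exact Finset.prod_le_prod (fun i _ => abs_nonneg _) fun i _ => hDb i (σ i) V)
      calc |∫ V, ∏ i, D i (σ i) V ∂μ| ≤ ∫ V, |∏ i, D i (σ i) V| ∂μ := abs_integral_le_integral_abs
        _ ≤ ∫ _V, ∏ i, sz (σ i) ∂μ := integral_mono hPi.abs (integrable_const _) fun V => by
            rw [Finset.abs_prod]
            exact Finset.prod_le_prod (fun i _ => abs_nonneg _) fun i _ => hDb i (σ i) V
        _ = ∏ i, sz (σ i) := by simp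
        _ = ∏ i, w (σ i) := Finset.prod_congr rfl fun i _ => (hw i).symm
  -- resummation over level assignments and the geometric level-weight sum
  have key := abs_integral_prod_sum_le μ (k + 1) D w hDm (fun i a => ⟨sz a, hDb i a⟩) hT
  have hsum : ∑ a ∈ Finset.range (k + 1), w a ≤ Cw / (((13 : ℕ) : ℝ) ^ k) ^ 4 := by
    have := levelWeights_sum_le (L := ((13 : ℕ) : ℝ)) (C₁ := C₁) (A := A) (δ := δ)
      (by norm_num) hC₁ hA0.le hδ k
    simp only [hwdef, hszdef, hCw]
    exact this
  have hRpos : (0 : ℝ) < (R : ℝ) := by exact_mod_cast hR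
  have hfin : (∑ a ∈ Finset.range (k + 1), w a) ^ n ≤ (Cw * 221 ^ 4 / (R : ℝ) ^ 4) ^ n := by
    refine pow_le_pow_left₀ (Finset.sum_nonneg fun a _ => hw0 a) (hsum.trans ?_) n
    have hR4 : (R : ℝ) ^ 4 ≤ 221 ^ 4 * (((13 : ℕ) : ℝ) ^ k) ^ 4 := by
      rw [← mul_pow]
      refine pow_le_pow_left₀ hRpos.le ?_ 4
      exact_mod_cast hk2.le
    rw [div_le_div_iff₀ (by positivity) (by positivity)]
    calc Cw * (R : ℝ) ^ 4 ≤ Cw * (221 ^ 4 * (((13 : ℕ) : ℝ) ^ k) ^ 4) :=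
          mul_le_mul_of_nonneg_left hR4 hCw0
      _ = Cw * 221 ^ 4 * (((13 : ℕ) : ℝ) ^ k) ^ 4 := by ring
  -- conclusion: the goal is `|∫ ∏ᵢ (pᵢ − mᵢ) dμ| ≤ (C/R⁴)ⁿ` by the definition of `torusEOn`
  change |∫ V, ∏ i, (pV i V - mV i) ∂μ| ≤ (Cw * 221 ^ 4 / (R : ℝ) ^ 4) ^ n
  rw [integral_congr_ae hprodae]
  exact key.trans hfin

end Summit.QuantumFields.YangMills.Theorems.BalabanTowerExport
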